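import Summits.ABC.IUTFork.Cor312ProvenanceFrames
import HarnessLib

/-!
# [IUTchIII] Cor. 3.12 — the provenance link `IsSettingOf D P` for the assembled real setting over volume frames,
# DEGREE-WEIGHTED form of the binder hypotheses (ADJUDICATION-SPEC §4 (iii); second reader's companion to
# `Cor312ProvenanceFrames.lean`)

Record-only PROOF companion of the abc-iut cell (wave-5 prover abc-iut-w5-d158, RQ7 second pass of p412742 with kernel
probe); TAKES NO SIDE on [IUTchIII] Cor. 3.12. Nothing of the author's file is restated or edited.

WHY. `Cor312Prov.isSettingOf_ofFrames` (abc-iut-c312-8, `Cor312ProvenanceFrames.lean`) instantiates the abstract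
criterion `negLogQ_eq_neg_absLogq_of_pieces_mod` (`Cor312ProvenanceMod.lean`), whose binders are a "weight × degree"
`wd_i` and a centre log-NORM `n_i`, with `wd := V.w` (the bare [IUTchIII] Rmk. 3.1.1 (ii) weight) and
`n := μ̇^log_i(λ_{q,i})` (the factor's log-VOLUME). The sum `Σ_i w_i·μ̇^log_i(λ_{q,i})` is the same either way, but the
resulting hypothesis (hbad) of `isSettingOf_ofFrames` prescribes ONE log-volume `−h_w·log N(w)/(2l·Pr(w))` for EVERY
field factor `i` of the packet lying over the bad place `w` of `F_mod`. At the Haar factor volume of [AbsTopIII]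
Prop. 5.7 (i) (`Cor312Vol.FactorVolume.ofUltrametric`; `ofUltrametric_mulLogvol`: `μ̇^log = mulLogVolume = −ord(·)·log q_K`)
the log-volume of the `2l`-th root `q̲` of the `q`-parameter in a factor `K_i ⊇ (F_mod)_w` is
`−ord_{K_i}(q̲)·log q_{K_i} = −[K_i : (F_mod)_w]·h_w·log N(w)/(2l)`, which DEPENDS on the factor through its degree — so
for a packet with two factors of different degree over the same bad `w` (the generic situation for the `(j+1)`-fold
tensor packets `⊗_{α ≤ j} K_{v̲_α}` of [IUTchIII] Prop. 3.1, `j ≥ 1`, whose simple factors are composita of different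
degrees) the per-factor form of (hbad) has no solution with genuine Haar volumes; it is satisfiable there only for
equal-degree factors (e.g. one field factor per place), or with the NON-Haar `FactorVolume`s that the free field
`FrameVolumePieces.vol` admits. The degree belongs in the hypothesis exactly as in abc-iut-c312-6's
`Cor312WeightSums.sum_factors_eq_sum_tuples` (`m_k = d_k·c(t k)`, `w_k = W(t k)/D(t k)`) and in [IUTchIII] Rmk. 3.1.1
(ii) p. 94 (the weight of a summand is the reciprocal of its degree data).

THIS FILE gives the degree-weighted form **`isSettingOf_ofFrames_of_degrees`**: the same conclusion
`IsSettingOf D (Setting.ofFrames …)` from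
* (hmargD) `Σ_{i over w} w_i·d_i = Pr(w)/[F_mod:ℚ]` and
* (hbadD) `μ̇^log_i(λ_{q,i}) = d_i·(−h_w·log N(w)/(2l·Pr(w)))`, (hgood) unchanged,
for ANY real "degrees" `d_i` of the pieces — at `d ≡ 1` its hypotheses are literally the author's (hmarg)/(hbad)
(so `isSettingOf_ofFrames` is the special case `d := fun _ _ _ => 1`; not restated here, gate dedup); at
`d_i := [K_i:(F_mod)_w]`, `Pr ≡ 1` it is the Haar-satisfiable form, where
(hbadD) reads "`λ_{q,i}` is (the image of) a `2l`-th root of the `q`-parameter, up to a unit" ([IUTchI] Ex. 3.2 (iv)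
`q̲_v̲`, whose existence in `K_v̲` the tree carries as the datum `qroot` of abc-iut-L5-t2's bad local Frobenioid structure).
PROVED by the author's own route (`negLogQ_eq_neg_absLogq_of_pieces_mod` with `wd := w·d`, `n :=` the place-level
log-norm, + `FrameVolumePieces.qLocal_ofFrames` + `isSettingOf_ofInitial`). The remaining free binders of
`Setting.ofFrames` (`lat`, `sig`, `split`, `qData`, `thetaBox`, `hq`, `hadm`, `hfin`) are untouched, as in the original.
[claim: Mochizuki2012, status: disputed] for every quotation; everything proved is finite-sum bookkeeping.
-/

noncomputable section

namespace Summit.ABC.IUTFork.Cor312Prov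

open Literature.IUT.HodgeTheaters Literature.IUT.LogVolume Literature.IUT.LogThetaLattice NumberField IsDedekindDomain
open Thm311 Cor312 Cor312Vol
open scoped Classical

variable {F K Fbar : Type} [Field F] [NumberField F] [Field K] [NumberField K]
  [Algebra F K] [Field Fbar] [Algebra F Fbar] [Algebra K Fbar] {E : WeierstrassCurve F} [E.IsElliptic]
  {l : ℕ} {Pb : BadPlacePredicates K}

/-- **`IsSettingOf D P` for the assembled real setting over volume frames, DEGREE-WEIGHTED hypotheses.** As
`isSettingOf_ofFrames`, but with a real "degree" `d_i` attached to each field factor: the marginal condition is on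
`Σ_{i over w} w_i·d_i` and the `q`-centre's factorwise log-volume over a bad `w` is `d_i` times the place-level
log-norm `−h_w·log N(w)/(2l·Pr(w))` of the `2l`-th root of the `q`-parameter ([IUTchIII] Rmk. 3.1.1 (ii) weights ×
[AbsTopIII] Prop. 5.7 (i) log-volumes; [IUTchIV] p. 23 "`|log(q)| = (1/2l)·log(q)`"). PROVED.
[claim: Mochizuki2012, status: disputed] -/
theorem isSettingOf_ofFrames_of_degrees (D : InitialThetaData F K Fbar E l Pb)
    {S : Situation (Thm311.Real.thetaIndexOfInitial D)}
    {V : FrameVolumePieces S.L} {n : ℤ}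
    {HT : Type} {LogLink : HT → HT → Type} {IsFull : ∀ {s t : HT}, LogLink s t → Prop}
    (lat : LGPGaussianLogThetaLattice LogLink IsFull)
    {Frd : Type} {IsoF : Frd → Frd → Type} {Ob : Frd → Type} {realify : Frd → Frd} {Strip : Type}
    {IsoS : Strip → Strip → Type} {M : ∀ v : (Thm311.Real.thetaIndexOfInitial D).V,
      v ∈ (Thm311.Real.thetaIndexOfInitial D).Vbad → Type} [∀ v h, Monoid (M v h)]
    (sig : GlobalLGPFrobenioidSignature (Thm311.Real.thetaIndexOfInitial D).lstar (Thm311.Real.thetaIndexOfInitial D).V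
      (· ∈ (Thm311.Real.thetaIndexOfInitial D).Vbad) Frd IsoF Ob realify Strip IsoS M)
    (split : SplittingMonoids M) {ObΔ : Type} {N : ∀ v : (Thm311.Real.thetaIndexOfInitial D).V,
      v ∈ (Thm311.Real.thetaIndexOfInitial D).Vbad → Type} [∀ v h, Monoid (N v h)]
    (qData : QPilotData ObΔ N)
    (thetaBox : ℤ → Ob sig.Clgp → ∀ j vQ, Set (∀ i, V.K j vQ i))
    (qCentre : ObΔ → ∀ j vQ, ∀ i, V.K j vQ i)
    (hq : ∀ j vQ i, qCentre (qPilotObject qData) j vQ i ≠ 0)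
    (hadm : ∀ j vQ (H : Set (∀ i, V.K j vQ i)), IsHullSet (V.K j vQ) H → (S.D n).Adm j vQ (V.e j vQ ⁻¹' H))
    (hfin : ∀ j : (Thm311.Real.thetaIndexOfInitial D).Label, (Function.support fun vQ => (S.D n).logvol j vQ
      (V.e j vQ ⁻¹' hullSet (V.K j vQ) (qCentre (qPilotObject qData) j vQ))).Finite)
    (hV : V.Realizes (S.D n))
    (jm : fieldOfModuli E) (hjm : (jm : F) = E.j)
    (gm : FinitePlace (fieldOfModuli E) → (Thm311.Real.thetaIndexOfInitial D).VQ)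
    (Pr : FinitePlace (fieldOfModuli E) → ℝ) (hPr : ∀ w ∈ D.VbadMod, Pr w ≠ 0)
    (π : ∀ (j : (Thm311.Real.thetaIndexOfInitial D).Label) (vQ : (Thm311.Real.thetaIndexOfInitial D).VQ),
      V.J j vQ → FinitePlace (fieldOfModuli E))
    (hπ : ∀ j vQ i, gm (π j vQ i) = vQ)
    -- the degree data of the pieces (e.g. `d_i = [K_i : (F_mod)_{π i}]`; any reals)
    (d : ∀ (j : (Thm311.Real.thetaIndexOfInitial D).Label) (vQ : (Thm311.Real.thetaIndexOfInitial D).VQ),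
      V.J j vQ → ℝ)
    (hmargD : ∀ j vQ, ∀ w ∈ D.VbadMod, gm w = vQ →
      ∑ i ∈ Finset.univ.filter (fun i => π j vQ i = w), V.w j vQ i * d j vQ i =
        Pr w / Module.finrank ℚ (fieldOfModuli E))
    (hbadD : ∀ j vQ i, π j vQ i ∈ D.VbadMod →
      (V.vol j vQ i).mulLogvol (qCentre (qPilotObject qData) j vQ i) =
        d j vQ i * (-(-(ord (fieldOfModuli E) (π j vQ i).maximalIdeal jm : ℝ) *
          logNorm (fieldOfModuli E) (π j vQ i).maximalIdeal) / (2 * (l : ℝ) * Pr (π j vQ i))))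
    (hgood : ∀ j vQ i, π j vQ i ∉ D.VbadMod → (V.vol j vQ i).mulLogvol (qCentre (qPilotObject qData) j vQ i) = 0) :
    IsSettingOf D (Setting.ofFrames n lat sig split qData (V.toRealFrames thetaBox qCentre) hq hadm hfin) := by
  refine isSettingOf_ofInitial D _ ?_
  refine negLogQ_eq_neg_absLogq_of_pieces_mod D jm hjm _ gm Pr hPr
    (fun i vQ => V.J (Setting.labelSucc i) vQ) (fun i vQ => π (Setting.labelSucc i) vQ)
    (fun i vQ x => hπ _ vQ x) (fun i vQ x => V.w (Setting.labelSucc i) vQ x * d (Setting.labelSucc i) vQ x)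
    (fun i vQ x => if π (Setting.labelSucc i) vQ x ∈ D.VbadMod then
      -(-(ord (fieldOfModuli E) (π (Setting.labelSucc i) vQ x).maximalIdeal jm : ℝ) *
          logNorm (fieldOfModuli E) (π (Setting.labelSucc i) vQ x).maximalIdeal) /
        (2 * (l : ℝ) * Pr (π (Setting.labelSucc i) vQ x)) else 0)
    (fun i vQ => hmargD _ vQ) (fun i vQ x hx => if_pos hx) (fun i vQ x hx => if_neg hx) ?_
  intro i vQ
  rw [FrameVolumePieces.qLocal_ofFrames lat sig split qData thetaBox qCentre hq hadm hfin hV (Setting.labelSucc i) vQ]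
  refine Finset.sum_congr rfl fun x _ => ?_
  by_cases hx : π (Setting.labelSucc i) vQ x ∈ D.VbadMod
  · rw [if_pos hx, hbadD _ vQ x hx]
    ring
  · rw [if_neg hx, hgood _ vQ x hx]
    ring

end Summit.ABC.IUTFork.Cor312Prov

end
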